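import Literature.AlgebraicGeometry.Motives.WeilJacobianAbelJacobiUnramified
import Literature.AlgebraicGeometry.Motives.JacobianAbelJacobiInjective
import Literature.AlgebraicGeometry.Motives.AbelianVarietyProjectiveChart
import Literature.AlgebraicGeometry.Morphisms.ClosedImmersionOfFiniteUnramified
import Literature.NumberTheory.DiophantineGeometry.FunctionFieldNonspecialDivisorsThroughPoint
import HarnessLib

/-!
# The Abel–Jacobi map is a closed immersion (Milne, *Jacobian Varieties*, §2 Prop. 2.3)

Layer `Literature/AlgebraicGeometry/Motives`, namespaces `….Motives.WeilJacobian` (§1–§4, Weil's data) and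
`….Motives.Jacobian` (§5).  THEOREMS ONLY (no definition, no named fact, no instance, sorry-free).

Milne, *Jacobian Varieties* §2, Prop. 2.3: «The map `f^P : C → J` is a closed immersion»; printed proof:
injective on points (for `g > 0` no two distinct points are linearly equivalent) and injective on tangent
vectors (via `Γ(C, Ω¹(−Q)) ⊊ Γ(C, Ω¹)`).  The tree had everything but the infinitesimal clause: injectivity on
points and on the underlying space, finiteness, and the reduction to «`f^P` is a monomorphism»
(★ `Motives/JacobianAbelJacobiInjective`, eds. 1–5), leaving the NAMED FACT `Milne1986_abelJacobi_isClosedImmersion`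
(★ `Motives/JacobianAbelJacobiTranslates`).  This file proves the proposition over an ALGEBRAICALLY CLOSED field
of characteristic `0` (in particular over `ℂ`, the case of every consumer of the named fact) WITHOUT differential
forms, through WEIL'S CHART: near each point, a translate of `f` is the composite

  `C ─s_{τ'}→ Cᵍ ─mk→ C^{(g)} ⊇ W ─f^{(g)}→ J`,   `s_{τ'}(x) = (τ'₀, …, x, …, τ'_{g−1})`,

with `s_{τ'}` a section of `pr_{j₀}` (closed immersion), `mk` ÉTALE off the big diagonal (★
`RelativeSpec/GeometricQuotientEtaleOnFreeLocus`, SGA 1 V 2.6), `W = {ℓ = 1}` Weil's chart and `f^{(g)}|_W` an OPEN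
IMMERSION (★ `WeilJacobian.isOpenImmersion_chartWOpens_ι_comp`, Milne Thm. 5.1 (a)); so `f` is formally
unramified, and «finite + unramified + injective on points ⇒ closed immersion» (★
`Morphisms/ClosedImmersionOfFiniteUnramified`, Hartshorne II 7.3's criterion) concludes.  The auxiliary tuple `τ'`
through `Q = τ'_{j₀}` needs `g − 1` further DISTINCT points with `ℓ(Q + Σ τ'ⱼ) = 1` (★
`FunctionFieldNonspecialDivisorsThroughPoint`, Milne Lemma 5.2 (b) pointed).

* §1–§3 (the tuple section, the general locus off the big diagonal, local unramifiedness of Weil's `f`) are ★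
  `Motives/WeilJacobianAbelJacobiUnramified` (`exists_opens_formallyUnramified_fJ`).
* §4 `exists_injective_tuple_ell_eq_one` (good tuples through every `K`-point, `g = genus ≥ 1`),
  **`formallyUnramified_fJ_left`** (the neighbourhoods cover `C`: every closed point is a `K`-point, `C` is
  Jacobson; unramifiedness is local at the source), **`formallyUnramified_abelJacobi_left`** (every Jacobian, every
  base point: `𝒥.J ≅ Jac`, ★ `exists_iso_abelJacobi_comp_eq_fJ`; change of base point = translation, ★
  `abelJacobi_eq_mul_const`).
* §5 **`Jacobian.isClosedImmersion_abelJacobi`** (`K = K̄`, `char K = 0`, `1 ≤ curveGenus C`, `C` integral smooth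
  proper projective; Weil's data discharged as in ★ `Jacobian.dim_eq_curveGenus`) and
  **`Jacobian.isClosedImmersion_abelJacobi_of_isSmoothProjective`** (over `ℂ`, `IsSmoothProjective 1 C`,
  `1 ≤ dim J` — literally the body of `Milne1986_abelJacobi_isClosedImmersion` at `k = ℂ`).
  -- TODO(general form): arbitrary base fields (Galois descent), positive characteristic; then the `def … : Prop`
  -- `Milne1986_abelJacobi_isClosedImmersion` can be replaced by a theorem (DEF desk: 2 consumers, both over ℂ).

Cell `hodgecm-mathlib` (D-0151), count-neutral capital (census `A-provers/A-p12/g11/CENSUS-MilneProp23-TangentClause.A-p12g11.md`).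
HC_CM is proved only modulo the 7 printed citations until rung 0 closes; this file discharges none of them.

Mathlib searched (pin): `FormallyUnramified.of_comp`, `IsZariskiLocalAtSource.of_iSup_eq_top`,
`IsClosedImmersion.of_comp` (sections of separated morphisms), `pullback.isIso_diagonal_iff` /
`[Mono f] → IsIso (diagonal f)` (closed immersions are unramified), `IsOpenImmersion.lift(_fac)`,
`nonempty_inter_closedPoints`, `Fin.insertNth_apply_same/succAbove`, `Fin.eq_self_or_eq_succAbove` (all used).

## References

* J. S. Milne, *Jacobian Varieties*, in G. Cornell, J. H. Silverman (eds.), *Arithmetic Geometry* (Storrs 1984),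
  Springer 1986, Ch. VII: §2 Prop. 2.3, §5 Thm. 5.1 (a), Lemma 5.2, §6 Lemma 6.7, Remark 6.5, §7 Thm. 7.1.
  [Milne1986JacobianVarieties]
* R. Hartshorne, *Algebraic Geometry* (1977), II Prop. 7.3. [Hartshorne1977]
* A. Grothendieck, *SGA 1*, Exp. V Prop. 2.6. [SGA1]
-/

set_option autoImplicit false

noncomputable section

universe u

open CategoryTheory CategoryTheory.Limits AlgebraicGeometry MonoidalCategory CartesianMonoidalCategory MonObj
  TopologicalSpace
open Literature.NumberTheory.DiophantineGeometry
open Literature.NumberTheory.DiophantineGeometry.AlgFunctionField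
open Literature.AlgebraicGeometry.RelativeSpec






namespace Literature.AlgebraicGeometry.Motives

open RatFn FieldPoint CartierDivisor CurvePlaces

namespace WeilJacobian

variable {K : Type u} [Field K] [IsAlgClosed K] [CharZero K]
  (C : SchemeOver K) [IsIntegral C.left] [SmoothOfRelativeDimension 1 C.hom] [IsProper C.hom]
  [GeometricallyIntegral C.hom] (hC : IsProjectiveOver C) (hX : CechPseudoCoherentAt C) (g : ℕ)
  (hg : (genus K (curveBC C (strPt (K := K) K)).left.functionField : ℤ) ≤ g)
  (hW : (chartW C g hC).Nonempty) (j₀ : Fin g)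

/-! ## §4 Good tuples through every point; `f` is formally unramified -/

omit [CharZero K] in
/-- **Through every `K`-point `Q` passes a good tuple**: for `g = genus(C) ≥ 1` there is an INJECTIVE tuple
`τ'` of `K`-points with `τ'_{j₀} = Q` and `ℓ(Σⱼ[τ'ⱼ]) = 1` (★ F2a `exists_injective_ell_single_add_sum_eq_one` —
Milne JV Lemma 5.2 (b), pointed form — fed with the places of `2g + 2` distinct `K`-points, ★ `infinite_algPoints`).
[cite: Milne1986JacobianVarieties, §5 Lemma 5.2 (b)] -/
theorem exists_injective_tuple_ell_eq_one
    (hgg : genus K (curveBC C (strPt (K := K) K)).left.functionField = g) (hg1 : 1 ≤ g) (Q : AlgPoints C K) :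
    ∃ τ' : Fin g → AlgPoints C K, Function.Injective τ' ∧ τ' j₀ = Q ∧ ell (tupleDiv C τ') = 1 := by
  classical
  obtain ⟨n, rfl⟩ : ∃ n, g = n + 1 := ⟨g - 1, by omega⟩
  -- places of `K`-points
  let pl : AlgPoints C K → PlaceOver K (curveBC C (strPt (K := K) K)).left.functionField := fun P =>
    place (curveBC C (strPt (K := K) K)) (ratPtPoint C _ P) (ratPtPoint_ne_genericPoint C _ P)
  have hpl : Function.Injective pl := fun P₁ P₂ h =>
    ratPtPoint_injective C _ (place_injective (C := curveBC C (strPt (K := K) K)) _ _ h)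
  have hdeg : ∀ P, (pl P).degree = 1 := fun P => PlaceOver.isRational_of_isAlgClosed _
  -- `2g + 2` rational places coming from `K`-points
  haveI := infinite_algPoints C
  let a := Infinite.natEmbedding (AlgPoints C K)
  have hinj' : Function.Injective fun i : Fin (2 * (n + 1) + 2) => pl (a i) := fun i j h =>
    Fin.ext (a.injective (hpl h))
  let emb : Fin (2 * (n + 1) + 2) ↪ PlaceOver K (curveBC C (strPt (K := K) K)).left.functionField :=
    ⟨fun i => pl (a i), hinj'⟩
  let S : Finset (PlaceOver K (curveBC C (strPt (K := K) K)).left.functionField) := Finset.univ.map emb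
  have hScard : S.card = 2 * (n + 1) + 2 := by
    simp only [S, Finset.card_map, Finset.card_univ, Fintype.card_fin]
  have hS : ∀ v ∈ S, v.degree = 1 := fun v hv => by
    obtain ⟨i, -, rfl⟩ := Finset.mem_map.mp hv
    exact hdeg _
  obtain ⟨v, hvinj, hvS, -, hvQ, hv⟩ := exists_injective_ell_single_add_sum_eq_one (K := K)
    (F := (curveBC C (strPt (K := K) K)).left.functionField) (by omega) (hdeg Q) ∅ S hS
    (by rw [hScard, Finset.card_empty, hgg]; omega)
  -- the chosen places come from `K`-points
  have hvP : ∀ i, ∃ P, pl P = v i := fun i => by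
    obtain ⟨j, -, hj⟩ := Finset.mem_map.mp (hvS i)
    exact ⟨a j, hj⟩
  choose P hP using hvP
  -- reindex `Fin (genus − 1) = Fin n` and insert `Q` at `j₀`
  have hn : genus K (curveBC C (strPt (K := K) K)).left.functionField - 1 = n := by omega
  let P' : Fin n → AlgPoints C K := fun i => P (Fin.cast hn.symm i)
  have hP'ne : ∀ i, P' i ≠ Q := fun i h => hvQ (Fin.cast hn.symm i) (by rw [← hP, ← h])
  have hP'inj : Function.Injective P' := fun i₁ i₂ h => by
    have := hvinj (by rw [← hP, ← hP]; exact congrArg pl h : v (Fin.cast hn.symm i₁) = v (Fin.cast hn.symm i₂))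
    exact (Fin.cast_injective _) this
  refine ⟨Fin.insertNth (α := fun _ => AlgPoints C K) j₀ Q P', ?_,
    Fin.insertNth_apply_same (α := fun _ => AlgPoints C K) j₀ Q P', ?_⟩
  · -- injectivity
    intro b₁ b₂ h
    rcases Fin.eq_self_or_eq_succAbove j₀ b₁ with h₁ | ⟨b₁', h₁⟩ <;>
      rcases Fin.eq_self_or_eq_succAbove j₀ b₂ with h₂ | ⟨b₂', h₂⟩
    · rw [h₁, h₂]
    · rw [h₁, h₂, Fin.insertNth_apply_same, Fin.insertNth_apply_succAbove] at h
      exact absurd h.symm (hP'ne b₂')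
    · rw [h₁, h₂, Fin.insertNth_apply_same, Fin.insertNth_apply_succAbove] at h
      exact absurd h (hP'ne b₁')
    · rw [h₁, h₂, Fin.insertNth_apply_succAbove, Fin.insertNth_apply_succAbove] at h
      rw [h₁, h₂, hP'inj h]
  · -- `ℓ(Σ[τ'ⱼ]) = ℓ([Q] + Σ[Pᵢ]) = 1`
    have hsum : tupleDiv C (Fin.insertNth j₀ Q P') =
        Finsupp.single (pl Q) 1 + ∑ i, Finsupp.single (v i) (1 : ℤ) := by
      simp only [tupleDiv]
      rw [Fin.sum_univ_succAbove _ j₀, Fin.insertNth_apply_same]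
      congr 1
      rw [← Equiv.sum_comp (finCongr hn.symm) (fun i => Finsupp.single (v i) (1 : ℤ))]
      refine Finset.sum_congr rfl fun i _ => ?_
      rw [Fin.insertNth_apply_succAbove, ← hP]
      rfl
    rw [hsum]
    exact hv

/-- **Weil's `f : C → J` is FORMALLY UNRAMIFIED** (`g = genus(C) ≥ 1`): the opens of §3 through the good
tuples of §4 cover every `K`-point, hence (Jacobson) all of `C`, and unramifiedness is local at the source.
[cite: Milne1986JacobianVarieties, §2 Prop. 2.3] -/
theorem formallyUnramified_fJ_left
    (hgg : genus K (curveBC C (strPt (K := K) K)).left.functionField = g) (hg1 : 1 ≤ g) :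
    FormallyUnramified (fJ C hC hX g hg hW j₀).left := by
  haveI : JacobsonSpace C.left := LocallyOfFiniteType.jacobsonSpace C.hom
  have hV : ∀ Q : AlgPoints C K, ∃ V : C.left.Opens,
      AlgPoints.pt Q ∈ V ∧ FormallyUnramified (V.ι ≫ (fJ C hC hX g hg hW j₀).left) := fun Q => by
    obtain ⟨τ', hinj, hQ, hℓ⟩ := exists_injective_tuple_ell_eq_one C g j₀ hgg hg1 Q
    obtain ⟨V, hV, hFU⟩ := exists_opens_formallyUnramified_fJ C hC hX g hg hW j₀ τ' hinj hℓ
    exact ⟨V, hQ ▸ hV, hFU⟩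
  choose V hVpt hVfu using hV
  refine IsZariskiLocalAtSource.of_iSup_eq_top V ?_ hVfu
  -- the `V_Q` cover `C`: their union is an open containing every closed point
  apply Opens.ext
  rw [Opens.coe_top]
  refine Set.eq_univ_iff_forall.mpr fun x => ?_
  by_contra hx
  have hZ : IsClosed ((⨆ Q, V Q : C.left.Opens) : Set C.left)ᶜ := (⨆ Q, V Q).2.isClosed_compl
  obtain ⟨x₀, hx₀Z, hx₀⟩ := nonempty_inter_closedPoints ⟨x, hx⟩ hZ.isLocallyClosed
  obtain ⟨Q, hQ⟩ := AlgPoints.exists_pt_eq_of_isClosed_singleton (X := C) (mem_closedPoints_iff.mp hx₀)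
  apply hx₀Z
  rw [SetLike.mem_coe, Opens.mem_iSup]
  exact ⟨Q, hQ ▸ hVpt Q⟩

omit [IsAlgClosed K] [CharZero K] [IsIntegral C.left] [SmoothOfRelativeDimension 1 C.hom] [IsProper C.hom]
  [GeometricallyIntegral C.hom] in
/-- Structure morphisms compose: `φ ≫ (Y → Spec K) = (X → Spec K)` in `SchemeOver K`. [folklore] -/
private theorem comp_toSpecOver_eq {X Y : SchemeOver K} (φ : X ⟶ Y) : φ ≫ toSpecOver Y = toSpecOver X := by
  ext : 1
  exact Over.w φ

include hC hX hg hW j₀ in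
/-- **The Abel–Jacobi map of EVERY Jacobian of `C` at EVERY base point is formally unramified** (Weil's
`(Jac, f)` data with `g = genus(C) ≥ 1`): `α_{R₀(j₀)} = f ≫ e⁻¹` for the isomorphism `e : 𝒥.J ≅ Jac` (★
`exists_iso_abelJacobi_comp_eq_fJ`) and `α_P = t ∘ α_{R₀(j₀)}` for a translation `t` (★ `abelJacobi_eq_mul_const`).
[cite: Milne1986JacobianVarieties, §2 Prop. 2.3 and Remark 6.5] -/
theorem formallyUnramified_abelJacobi_left
    (hgg : genus K (curveBC C (strPt (K := K) K)).left.functionField = g) (hg1 : 1 ≤ g)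
    (𝒥 : Jacobian C) (P : AlgPoints C K) : FormallyUnramified (𝒥.abelJacobi P).left := by
  have hFU : ∀ {X₁ X₂ X₃ : Scheme.{u}} (a : X₁ ⟶ X₂) (b : X₂ ⟶ X₃), FormallyUnramified a → FormallyUnramified b →
      FormallyUnramified (a ≫ b) := fun a b ha hb => MorphismProperty.comp_mem _ a b ha hb
  obtain ⟨e, -, he⟩ := exists_iso_abelJacobi_comp_eq_fJ C hC hX g hg hW j₀ 𝒥
  -- the base point `R₀(j₀)`
  have h0 : FormallyUnramified (𝒥.abelJacobi (baseTuple C hC hX g hW j₀)).left := by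
    rw [← he]
    have h1 : AbelianVariety.Hom.toSchemeHom e.inv ≫ AbelianVariety.Hom.toSchemeHom e.hom = 𝟙 _ := by
      change AbelianVariety.Hom.toSchemeHom (e.inv ≫ e.hom) = _
      rw [e.inv_hom_id]
      rfl
    have h2 : AbelianVariety.Hom.toSchemeHom e.hom ≫ AbelianVariety.Hom.toSchemeHom e.inv = 𝟙 _ := by
      change AbelianVariety.Hom.toSchemeHom (e.hom ≫ e.inv) = _
      rw [e.hom_inv_id]
      rfl
    haveI : IsIso (AbelianVariety.Hom.toSchemeHom e.inv) := ⟨AbelianVariety.Hom.toSchemeHom e.hom, h1, h2⟩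
    exact hFU _ _ (formallyUnramified_fJ_left C hC hX g hg hW j₀ hgg hg1) inferInstance
  -- any base point: `α_P = α_{R₀(j₀)} ≫ t_c`
  set c : 𝒥.J.Points K := (P ≫ 𝒥.abelJacobi (baseTuple C hC hX g hW j₀))⁻¹ with hc
  have heq : 𝒥.abelJacobi P = 𝒥.abelJacobi (baseTuple C hC hX g hW j₀) ≫ 𝒥.J.translation c := by
    rw [𝒥.abelJacobi_eq_mul_const (baseTuple C hC hX g hW j₀) P, AbelianVariety.translation, MonObj.comp_mul,
      Category.comp_id, ← Category.assoc, comp_toSpecOver_eq, mul_comm]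
  rw [heq, Over.comp_left]
  haveI : IsIso (𝒥.J.translation c).left :=
    (inferInstance : IsIso ((Over.forget _).map (𝒥.J.translationIso c).hom))
  exact hFU _ _ h0 inferInstance

end WeilJacobian

/-! ## §5 Milne, *Jacobian Varieties*, Prop. 2.3: `f^P : C → J` is a closed immersion -/

namespace Jacobian

/-- **Milne, *Jacobian Varieties*, Prop. 2.3 over an algebraically closed field of characteristic `0`: for a
smooth projective curve `C` of genus `≥ 1`, EVERY Jacobian `𝒥` of `C` and every base point `P ∈ C(K)`, the
Abel–Jacobi map `f^P = 𝒥.abelJacobi P : C → J` is a CLOSED IMMERSION.**  Finite (★ `isFinite_abelJacobi`),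
injective on points (★ `abelJacobi_base_injective`), formally unramified (Weil's chart, §4), trivial residue
extensions at the closed points (`K = K̄`, ★ `surjective_residueFieldMap_of_isClosed`) ⇒ closed immersion (★ F2b
`isClosedImmersion_of_isFinite_of_formallyUnramified_of_injective`, Hartshorne II 7.3's criterion).  The Weil
data (`hX`, `g = genus`, `W ≠ ∅`) are discharged as in ★ `Jacobian.dim_eq_curveGenus`.
[cite: Milne1986JacobianVarieties, §2 Prop. 2.3 (p. 173)] [cite: Hartshorne1977, II Prop. 7.3] -/
theorem isClosedImmersion_abelJacobi {K : Type u} [Field K] [IsAlgClosed K] [CharZero K]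
    (C : SchemeOver K) [IsIntegral C.left] [SmoothOfRelativeDimension 1 C.hom] [IsProper C.hom]
    (hC : IsProjectiveOver C) (hpos : 1 ≤ curveGenus C) (𝒥 : Jacobian C) (P : AlgPoints C K) :
    IsClosedImmersion (𝒥.abelJacobi P).left := by
  haveI : GeometricallyIntegral C.hom := geometricallyIntegral_of_isAlgClosed C.hom
  -- Weil's data at `g = genus(C)`
  have hX : CechPseudoCoherentAt C := cechPseudoCoherentAt_of_general cechComplex_pseudoCoherent_general_holds C
  have hgg : genus K (curveBC C (strPt (K := K) K)).left.functionField = curveGenus C := by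
    have h := curveGenus_curveBC C (strPt (K := K) K)
    unfold curveGenus at h ⊢
    exact h
  have hg : (genus K (curveBC C (strPt (K := K) K)).left.functionField : ℤ) ≤ curveGenus C := by
    exact_mod_cast hgg.le
  haveI := infinite_algPoints C
  let a := Infinite.natEmbedding (AlgPoints C K)
  let s : Fin (2 * curveGenus C) → (𝟙_ (SchemeOver K) ⟶ C) := fun j ↦ unitToSpecOver K ≫ a j
  have hs : Function.Injective s := fun j₁ j₂ h ↦ by
    have h' := congrArg (toUnit (specOver K K) ≫ ·) h
    simp only [s] at h'
    rw [← Category.assoc, toUnit_unitToSpecOver, Category.id_comp, ← Category.assoc, toUnit_unitToSpecOver,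
      Category.id_comp] at h'
    exact Fin.val_injective (a.injective h')
  have hW : (chartW C (curveGenus C) hC).Nonempty :=
    chartW_nonempty C (curveGenus C) hC (nonempty_generalLocus_of_sections C s hs (by omega))
  -- the four inputs of the criterion
  haveI := isFinite_abelJacobi hC hpos 𝒥 P
  haveI : FormallyUnramified (𝒥.abelJacobi P).left :=
    WeilJacobian.formallyUnramified_abelJacobi_left C hC hX (curveGenus C) hg hW ⟨0, hpos⟩ hgg hpos 𝒥 P
  haveI : JacobsonSpace C.left := LocallyOfFiniteType.jacobsonSpace C.hom
  exact Literature.AlgebraicGeometry.Morphisms.isClosedImmersion_of_isFinite_of_formallyUnramified_of_injective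
    (𝒥.abelJacobi P).left (abelJacobi_base_injective hC hpos 𝒥 P) fun x hx =>
      ChartFamily.surjective_residueFieldMap_of_isClosed C.hom 𝒥.J.X.hom (𝒥.abelJacobi P).left
        (Over.w (𝒥.abelJacobi P)) hx

/-- **Milne Prop. 2.3 in the `IsSmoothProjective` currency over `ℂ`** (the setting of the named fact
`Milne1986_abelJacobi_isClosedImmersion` of ★ `Motives/JacobianAbelJacobiTranslates` and of its consumers): for a
smooth projective complex curve `C`, every Jacobian `𝒥` with `dim J ≥ 1` and every `P ∈ C(ℂ)`, `f^P` is a closed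
immersion (`dim J = g(C)`, ★ `dim_le_curveGenus`). [cite: Milne1986JacobianVarieties, §2 Prop. 2.3 (p. 173)] -/
theorem isClosedImmersion_abelJacobi_of_isSmoothProjective {C : SchemeOver ℂ} (hC : IsSmoothProjective 1 C)
    (𝒥 : Jacobian C) (hdim : 1 ≤ 𝒥.J.dim) (P : AlgPoints C ℂ) : IsClosedImmersion (𝒥.abelJacobi P).left := by
  haveI : IsIntegral C.left := IsSmoothProjective.isIntegral_holds hC
  haveI : SmoothOfRelativeDimension 1 C.hom := hC.smoothOfRelativeDimension
  haveI : IsProper C.hom := IsSmoothProjective.isProper_holds hC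
  have hle : 𝒥.J.dim ≤ curveGenus C :=
    Literature.AlgebraicGeometry.HodgeTheory.Jacobian.dim_le_curveGenus (C := C) hC 𝒥
  exact isClosedImmersion_abelJacobi C hC.isProjectiveOver (hdim.trans hle) 𝒥 P

end Jacobian

end Literature.AlgebraicGeometry.Motives

end
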